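import Summits.AtomisticToContinuum.FouriersLaw.Theorems.PhononMeanFreePathIncoherentChannelChannelBookkeeping
import Summits.AtomisticToContinuum.FouriersLaw.Theorems.IncoherentChannel.Negative.LineResistance

/-!
# Crux-strategist r1 sketch — crux `PhononMeanFreePath.IncoherentChannel` (stmt-AtomisticToContinuum-11811)

Typed objects behind Part R1 of `STRATEGY-CENSUS.md` (planner-cstrat-stmt-AtomisticToContinuum-11811-r1-0,
2026-08-17, redirect strategist after the route was BLOCKED on the s2 verdict). Nothing here is a route item
or a registered stub; the file certifies that the new signatures of Part R1 elaborate and that the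
certificates it quotes are real (sorry-free). Companion of `StrategistSketch.lean` (s1) and
`StrategistS2Sketch.lean` (s2), which are not repeated.

Notation: `(N+1)`-site pinned anharmonic chain with both baths at `T`; `C_N = powerCov`, `r_N = pairCorr`;
`kuboSeq N = N(γ²/T²)∫₀^∞ C_N` (= BLR's `D_{N+1}` by the proved `boundaryKubo_proof`), `cruxSeq N =
N(γ²/T²)∫₀^∞ (C_N − 2r_N²)` (the crux's sequence), `cohSeq N = N∫₀^∞ r_N²` (coherent channel).

* THE SUMMIT-STRENGTH CERTIFICATE IN TRIBUNAL (T1) SHAPE. `KuboLimitExists` (the scaled conductance has SOME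
  limit) and `KuboFloor` (it is eventually `≥ c > 0`) are the two natural pieces of every split of the crux
  that uses the route's rank-2 crux `CoherentDephasing` (D1 of s1, D2′ of s2, the live line's
  `stub_varianceLimit`). `incoherentChannel_of_dominating`: `CoherentDephasing → KuboLimitExists → KuboFloor →
  IncoherentChannel` (sorry-free glue) — AND `fouriersLaw_of_dominating`: `KuboLimitExists → KuboFloor →
  FouriersLaw` WITHOUT the crux and without `CoherentDephasing`; conversely `dominating_of_fouriersLaw`. So the
  dominating hypothesis of the crux is the sub-problem conjunct itself (`dominating_iff_fouriersLaw`), and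
  given the rank-2 crux the three statements coincide (`crux_iff_dominating_of_coherentDephasing`, from the
  landed `Negative.LineResistance.incoherentChannel_iff_fouriersLaw_of_coherentDephasing`).
* (D-R1.1) TAUBERIAN SPLIT of the existence half: `CesaroKubo` ((C,1)-limit of `kuboSeq`, positive) and
  `SlowlyDecreasingKubo` (R. Schmidt's one-sided condition), both CONSEQUENCES of the conjunct
  (`cesaroKubo_of_fouriersLaw`, `slowlyDecreasingKubo_of_fouriersLaw`); the converse is Hardy's Tauberian
  theorem (Divergent Series, Thm 68), kept as the explicit hypothesis `SchmidtTauberian` of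
  `fouriersLaw_of_tauberianPieces` (not in Mathlib; not proved here).
* (S-R1.2) `UniformInCouplingKubo` — an `N`-uniform bound on the scaled conductance uniform in the couplings
  `(lam, β) ∈ (0,1]²` (signature only; false in substance at the harmonic corner, see the census).
* NEGATION SHAPE. `not_fouriersLaw_of_counterexample`: under the rank-2 crux a counterexample to this crux is a
  counterexample to Fourier's law for the pinned anharmonic chain.
-/

noncomputable section

namespace Summit.AtomisticToContinuum.FouriersLaw.Cruxes.IncoherentChannel.StrategistR1

open MeasureTheory Set Filter Topology Finset
open Literature.MathematicalPhysics.KineticTheory.HeatConduction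
open Summit.AtomisticToContinuum.FouriersLaw.Theses.PhononMeanFreePath (IncoherentChannel CoherentDephasing)
open Summit.AtomisticToContinuum.FouriersLaw.Theorems.PhononMeanFreePath
open Summit.AtomisticToContinuum.FouriersLaw.Theorems.IncoherentChannel.Negative.LineResistance
  (incoherentChannel_iff_fouriersLaw_of_coherentDephasing)

/-! ## Vocabulary -/

/-- Kubo-form scaled conductance `a_N = N(γ²/T²)∫₀^∞ C_N dt` (`= D_{N+1}` of BLR by `boundaryKubo_proof`). -/
def kuboSeq (ω₂ lam β γ T : ℝ) (N : ℕ) : ℝ :=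
  (N : ℝ) * (γ ^ 2 / T ^ 2) * ∫ t in Ioi (0 : ℝ), powerCov ω₂ lam β γ T N t

/-- The crux's own sequence `i_N = N(γ²/T²)∫₀^∞ (C_N − 2 r_N²) dt`. -/
def cruxSeq (ω₂ lam β γ T : ℝ) (N : ℕ) : ℝ :=
  (N : ℝ) * (γ ^ 2 / T ^ 2) *
    ∫ t in Ioi (0 : ℝ), (powerCov ω₂ lam β γ T N t - 2 * (pairCorr ω₂ lam β γ T N t) ^ 2)

/-- The coherent (Landauer) channel `N∫₀^∞ r_N² dt` (the rank-2 crux says it tends to `0`). -/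
def cohSeq (ω₂ lam β γ T : ℝ) (N : ℕ) : ℝ :=
  (N : ℝ) * ∫ t in Ioi (0 : ℝ), (pairCorr ω₂ lam β γ T N t) ^ 2

/-- `cruxSeq` is the sequence printed in the crux. -/
theorem cruxSeq_eq (ω₂ lam β γ T : ℝ) (N : ℕ) :
    cruxSeq ω₂ lam β γ T N = (N : ℝ) * (γ ^ 2 / T ^ 2) * ∫ t in Ioi (0 : ℝ),
      ((∫ z, (z.2 0) ^ 2 * (∫ y, (y.2 (Fin.last N)) ^ 2
          ∂((pinnedChain ω₂ lam β γ).transitionKernel (N + 1) T T t.toNNReal z))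
          ∂((pinnedChain ω₂ lam β γ).gibbsMeasure (N + 1) T)) -
        (∫ z, (z.2 0) ^ 2 ∂((pinnedChain ω₂ lam β γ).gibbsMeasure (N + 1) T)) *
          (∫ z, (∫ y, (y.2 (Fin.last N)) ^ 2
            ∂((pinnedChain ω₂ lam β γ).transitionKernel (N + 1) T T t.toNNReal z))
            ∂((pinnedChain ω₂ lam β γ).gibbsMeasure (N + 1) T)) -
        2 * (∫ z, z.2 0 * (∫ y, y.2 (Fin.last N)
          ∂((pinnedChain ω₂ lam β γ).transitionKernel (N + 1) T T t.toNNReal z))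
          ∂((pinnedChain ω₂ lam β γ).gibbsMeasure (N + 1) T)) ^ 2) := by
  simp only [cruxSeq, cruxIntegrand_eq]

/-- The crux in the vocabulary of this file (definitional). -/
theorem incoherentChannel_iff_cruxSeq :
    IncoherentChannel ↔ ∀ ω₂ lam β γ : ℝ, 0 < ω₂ → 0 < lam → 0 < β → 0 < γ → ∀ T : ℝ, 0 < T →
      ∃ κ : ℝ, 0 < κ ∧ Tendsto (cruxSeq ω₂ lam β γ T) atTop (𝓝 κ) := by
  simp only [IncoherentChannel, funext (cruxSeq_eq _ _ _ _ _)]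

/-- The rank-2 crux in this vocabulary: `cohSeq → 0` at every admissible parameter point. -/
theorem cohSeq_tendsto_zero_of_coherentDephasing (hA : CoherentDephasing) {ω₂ lam β γ : ℝ}
    (hω : 0 < ω₂) (hl : 0 < lam) (hβ : 0 < β) (hγ : 0 < γ) {T : ℝ} (hT : 0 < T) :
    Tendsto (cohSeq ω₂ lam β γ T) atTop (𝓝 0) := by
  have h := (hA ω₂ lam β γ hω hl hβ hγ T hT).2
  refine h.congr fun N => ?_
  simp only [cohSeq, pairCorr, fcast]

/-- Exact two-channel bookkeeping `kuboSeq = cruxSeq + 2(γ²/T²)·cohSeq` at every `N` (landed for item 11815,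
`IncoherentBounded.kubo_eq_seq_add_coherent`; fixed-`N` integrability of both channels is inside it). -/
theorem kuboSeq_eq_cruxSeq_add {ω₂ lam β γ : ℝ} (hω : 0 < ω₂) (hl : 0 < lam) (hβ : 0 < β) (hγ : 0 < γ)
    {T : ℝ} (hT : 0 < T) (N : ℕ) :
    kuboSeq ω₂ lam β γ T N = cruxSeq ω₂ lam β γ T N + 2 * (γ ^ 2 / T ^ 2) * cohSeq ω₂ lam β γ T N := by
  simp only [kuboSeq, cruxSeq, cohSeq]
  exact Summit.AtomisticToContinuum.FouriersLaw.Theorems.IncoherentBounded.kubo_eq_seq_add_coherent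
    hω hl hβ hγ hT N

/-! ## The dominating hypothesis of the crux is the conjunct (tribunal T1 shape) -/

/-- **Piece "existence"**: the scaled two-terminal conductance has SOME real limit (no positivity). TRUE is
not known anywhere off the harmonic corner; FALSE at the harmonic corner (`kuboSeq ≍ N`, Rieder–Lebowitz–Lieb).
BLR 2000 §6.3: "the limit L → ∞ is the crux of the matter". -/
def KuboLimitExists : Prop :=
  ∀ ω₂ lam β γ : ℝ, 0 < ω₂ → 0 < lam → 0 < β → 0 < γ → ∀ T : ℝ, 0 < T →
    ∃ L : ℝ, Tendsto (kuboSeq ω₂ lam β γ T) atTop (𝓝 L)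

/-- **Piece "floor"**: the scaled conductance is eventually `≥ c > 0` (Ohmic lower bound; =
`JunctionLocality.ConductanceLowerBound`, stmt-11749, in Kubo form — `conductanceLowerBound_of_incoherentChannel`
shows the crux already implies it BY NAME). TRUE at the harmonic corner. -/
def KuboFloor : Prop :=
  ∀ ω₂ lam β γ : ℝ, 0 < ω₂ → 0 < lam → 0 < β → 0 < γ → ∀ T : ℝ, 0 < T →
    ∃ c : ℝ, 0 < c ∧ ∀ᶠ N : ℕ in atTop, c ≤ kuboSeq ω₂ lam β γ T N

/-- **Glue of the natural three-piece split** `CoherentDephasing ∧ KuboLimitExists ∧ KuboFloor → IncoherentChannel`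
(`cruxSeq = kuboSeq − 2(γ²/T²)cohSeq → L − 0`, and `L ≥ c > 0`). Sorry-free. -/
theorem incoherentChannel_of_dominating (hA : CoherentDephasing) (hL : KuboLimitExists) (hF : KuboFloor) :
    IncoherentChannel := by
  rw [incoherentChannel_iff_cruxSeq]
  intro ω₂ lam β γ hω hl hβ hγ T hT
  obtain ⟨L, hLlim⟩ := hL ω₂ lam β γ hω hl hβ hγ T hT
  obtain ⟨c, hc, hev⟩ := hF ω₂ lam β γ hω hl hβ hγ T hT
  have hcL : c ≤ L := ge_of_tendsto hLlim hev
  have hcoh := cohSeq_tendsto_zero_of_coherentDephasing hA hω hl hβ hγ hT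
  have hdiff := hLlim.sub (hcoh.const_mul (2 * (γ ^ 2 / T ^ 2)))
  simp only [mul_zero, sub_zero] at hdiff
  refine ⟨L, lt_of_lt_of_le hc hcL, hdiff.congr fun N => ?_⟩
  have h := kuboSeq_eq_cruxSeq_add hω hl hβ hγ hT N
  linarith

/-- **The same two pieces give the CONJUNCT directly, without the crux and without `CoherentDephasing`**
(Kubo form of Fourier's law, `fouriersLaw_of_kuboForm`, p93864). -/
theorem fouriersLaw_of_dominating (hL : KuboLimitExists) (hF : KuboFloor) : _root_.FouriersLaw := by
  refine fouriersLaw_of_kuboForm fun ω₂ lam β γ hω hl hβ hγ T hT => ?_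
  obtain ⟨L, hLlim⟩ := hL ω₂ lam β γ hω hl hβ hγ T hT
  obtain ⟨c, hc, hev⟩ := hF ω₂ lam β γ hω hl hβ hγ T hT
  exact ⟨L, lt_of_lt_of_le hc (ge_of_tendsto hLlim hev), hLlim⟩

/-- **Conversely the conjunct gives both pieces** (`kuboForm_of_fouriersLaw`). -/
theorem dominating_of_fouriersLaw (hS : _root_.FouriersLaw) : KuboLimitExists ∧ KuboFloor := by
  refine ⟨fun ω₂ lam β γ hω hl hβ hγ T hT => ?_, fun ω₂ lam β γ hω hl hβ hγ T hT => ?_⟩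
  · obtain ⟨κ, -, hκ⟩ := kuboForm_of_fouriersLaw hS ω₂ lam β γ hω hl hβ hγ T hT
    exact ⟨κ, hκ⟩
  · obtain ⟨κ, hκpos, hκ⟩ := kuboForm_of_fouriersLaw hS ω₂ lam β γ hω hl hβ hγ T hT
    refine ⟨κ / 2, by positivity, ?_⟩
    have : ∀ᶠ N : ℕ in atTop, kuboSeq ω₂ lam β γ T N ∈ Ioi (κ / 2) := hκ (Ioi_mem_nhds (by linarith))
    exact this.mono fun N hN => le_of_lt hN

/-- **T1 certificate.** The dominating hypothesis of every known split of the crux is the conjunct itself: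
`(KuboLimitExists ∧ KuboFloor) ↔ FouriersLaw`, unconditionally. -/
theorem dominating_iff_fouriersLaw : (KuboLimitExists ∧ KuboFloor) ↔ _root_.FouriersLaw :=
  ⟨fun h => fouriersLaw_of_dominating h.1 h.2, dominating_of_fouriersLaw⟩

/-- **Given the rank-2 crux, crux = pieces = conjunct.** (`Negative.LineResistance` + the two theorems above.) -/
theorem crux_iff_dominating_of_coherentDephasing (hA : CoherentDephasing) :
    IncoherentChannel ↔ (KuboLimitExists ∧ KuboFloor) :=
  (incoherentChannel_iff_fouriersLaw_of_coherentDephasing hA).trans dominating_iff_fouriersLaw.symm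

/-- The floor piece is already NECESSARY for the crux, unconditionally (landed bookkeeping
`kuboFloor_of_incoherentChannel`, restated in this vocabulary). -/
theorem kuboFloor_of_crux (h : IncoherentChannel) : KuboFloor := by
  intro ω₂ lam β γ hω hl hβ hγ T hT
  simpa only [KuboFloor, kuboSeq] using kuboFloor_of_incoherentChannel h ω₂ lam β γ hω hl hβ hγ T hT

/-! ## (D-R1.1) Tauberian split of the existence half: Cesàro limit + slow decrease -/

/-- **(C,1)-form of the conjunct**: the Cesàro means of the scaled conductance converge to a POSITIVE limit. -/
def CesaroKubo : Prop :=
  ∀ ω₂ lam β γ : ℝ, 0 < ω₂ → 0 < lam → 0 < β → 0 < γ → ∀ T : ℝ, 0 < T →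
    ∃ κ : ℝ, 0 < κ ∧
      Tendsto (fun n : ℕ => (n⁻¹ : ℝ) * ∑ i ∈ range n, kuboSeq ω₂ lam β γ T i) atTop (𝓝 κ)

/-- **R. Schmidt's slow decrease** of `N ↦ kuboSeq N` ("no abrupt relative drop of the scaled conductance over
length windows `[N, (1+δ)N]`"): for every `ε > 0` there are `δ > 0` and `N₀` with `kuboSeq M ≥ kuboSeq N − ε`
whenever `N₀ ≤ N ≤ M ≤ (1+δ)N`. Weaker than eventual monotonicity (s1 S1) and than Landau's one-sided
increment condition; satisfied by any scaling form `kuboSeq N = f(N/ℓ) + o(1)` with `f` Lipschitz. -/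
def SlowlyDecreasingKubo : Prop :=
  ∀ ω₂ lam β γ : ℝ, 0 < ω₂ → 0 < lam → 0 < β → 0 < γ → ∀ T : ℝ, 0 < T →
    ∀ ε : ℝ, 0 < ε → ∃ δ : ℝ, 0 < δ ∧ ∃ N₀ : ℕ, ∀ N M : ℕ, N₀ ≤ N → N ≤ M →
      (M : ℝ) ≤ (1 + δ) * N → kuboSeq ω₂ lam β γ T N - ε ≤ kuboSeq ω₂ lam β γ T M

/-- Hardy's Tauberian theorem for slowly decreasing sequences (Schmidt 1925; Hardy, *Divergent Series*,
Thm 68): (C,1)-convergent + slowly decreasing ⇒ convergent. Not in Mathlib; carried as an explicit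
hypothesis of the glue below, never asserted. -/
def SchmidtTauberian : Prop :=
  ∀ (u : ℕ → ℝ) (l : ℝ),
    Tendsto (fun n : ℕ => (n⁻¹ : ℝ) * ∑ i ∈ range n, u i) atTop (𝓝 l) →
    (∀ ε : ℝ, 0 < ε → ∃ δ : ℝ, 0 < δ ∧ ∃ N₀ : ℕ, ∀ N M : ℕ, N₀ ≤ N → N ≤ M →
      (M : ℝ) ≤ (1 + δ) * N → u N - ε ≤ u M) →
    Tendsto u atTop (𝓝 l)

/-- The Cesàro piece is a CONSEQUENCE of the conjunct (`Filter.Tendsto.cesaro`). -/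
theorem cesaroKubo_of_fouriersLaw (hS : _root_.FouriersLaw) : CesaroKubo := by
  intro ω₂ lam β γ hω hl hβ hγ T hT
  obtain ⟨κ, hκpos, hκ⟩ := kuboForm_of_fouriersLaw hS ω₂ lam β γ hω hl hβ hγ T hT
  exact ⟨κ, hκpos, hκ.cesaro⟩

/-- The slow-decrease piece is a CONSEQUENCE of the conjunct (a convergent sequence is slowly decreasing,
with any `δ`). -/
theorem slowlyDecreasingKubo_of_fouriersLaw (hS : _root_.FouriersLaw) : SlowlyDecreasingKubo := by
  intro ω₂ lam β γ hω hl hβ hγ T hT ε hε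
  obtain ⟨κ, -, hκ⟩ := kuboForm_of_fouriersLaw hS ω₂ lam β γ hω hl hβ hγ T hT
  have hev : ∀ᶠ N : ℕ in atTop, dist (kuboSeq ω₂ lam β γ T N) κ < ε / 2 :=
    (Metric.tendsto_nhds.1 hκ) (ε / 2) (half_pos hε)
  obtain ⟨N₀, hN₀⟩ := eventually_atTop.1 hev
  refine ⟨1, one_pos, N₀, fun N M hN hNM _ => ?_⟩
  have h1 := hN₀ N hN
  have h2 := hN₀ M (hN.trans hNM)
  rw [Real.dist_eq] at h1 h2
  have h1' := (abs_lt.1 h1)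
  have h2' := (abs_lt.1 h2)
  linarith [h1'.1, h1'.2, h2'.1, h2'.2]

/-- **Glue of the Tauberian split** (modulo Hardy's theorem as a hypothesis): Cesàro limit + slow decrease
⇒ the conjunct (Kubo form). Which piece is the whole crux: `CesaroKubo` (see the census). -/
theorem fouriersLaw_of_tauberianPieces (hH : SchmidtTauberian) (hC : CesaroKubo)
    (hD : SlowlyDecreasingKubo) : _root_.FouriersLaw := by
  refine fouriersLaw_of_kuboForm fun ω₂ lam β γ hω hl hβ hγ T hT => ?_
  obtain ⟨κ, hκpos, hκ⟩ := hC ω₂ lam β γ hω hl hβ hγ T hT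
  exact ⟨κ, hκpos, hH _ κ hκ (hD ω₂ lam β γ hω hl hβ hγ T hT)⟩

/-! ## (S-R1.2) Strengthen: uniformity in the couplings (signature only) -/

/-- **Scaled conductance bounded uniformly in `N` AND in the couplings `(lam, β) ∈ (0,1]²`** at fixed
`(ω₂, γ, T)`. A strengthening of `BoundedResponse` one would need for any compactness-in-the-coupling
argument (Vitali/Montel continuation from a solvable corner). False in substance: at fixed `N` the kernels
should depend continuously on `(lam, β)` down to the harmonic corner, where `kuboSeq ≍ N`
(`HarmonicCoherentPersistence`, Rieder–Lebowitz–Lieb); the fixed-`N` continuity is itself unproved, so no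
refutation is typed here. -/
def UniformInCouplingKubo : Prop :=
  ∀ ω₂ γ T : ℝ, 0 < ω₂ → 0 < γ → 0 < T → ∃ B : ℝ, ∀ lam β : ℝ, 0 < lam → lam ≤ 1 → 0 < β → β ≤ 1 →
    ∀ N : ℕ, kuboSeq ω₂ lam β γ T N ≤ B

/-! ## Negation shape -/

/-- Under the rank-2 crux, a counterexample to this crux IS a counterexample to Fourier's law for the pinned
anharmonic chain (landed `Negative.LineResistance`). -/
theorem not_fouriersLaw_of_counterexample (hA : CoherentDephasing) (h : ¬ IncoherentChannel) :
    ¬ _root_.FouriersLaw :=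
  fun hS => h ((incoherentChannel_iff_fouriersLaw_of_coherentDephasing hA).2 hS)

/-- Without the rank-2 crux: a counterexample to this crux at a point where Fourier's law holds forces the
coherent channel NOT to converge to any limit `c` with `κ_F > 2(γ²/T²)c` — i.e. it lives entirely on the
rank-2 side. Typed: if the conjunct holds and the coherent channel tends to `0`, the crux holds. -/
theorem crux_of_fouriersLaw_of_cohSeq_tendsto_zero (hS : _root_.FouriersLaw)
    (hcoh : ∀ ω₂ lam β γ : ℝ, 0 < ω₂ → 0 < lam → 0 < β → 0 < γ → ∀ T : ℝ, 0 < T →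
      Tendsto (cohSeq ω₂ lam β γ T) atTop (𝓝 0)) : IncoherentChannel := by
  rw [incoherentChannel_iff_cruxSeq]
  intro ω₂ lam β γ hω hl hβ hγ T hT
  obtain ⟨κ, hκpos, hκ⟩ := kuboForm_of_fouriersLaw hS ω₂ lam β γ hω hl hβ hγ T hT
  have hdiff := hκ.sub ((hcoh ω₂ lam β γ hω hl hβ hγ T hT).const_mul (2 * (γ ^ 2 / T ^ 2)))
  simp only [mul_zero, sub_zero] at hdiff
  refine ⟨κ, hκpos, hdiff.congr fun N => ?_⟩
  have h := kuboSeq_eq_cruxSeq_add hω hl hβ hγ hT N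
  simp only [kuboSeq] at h ⊢
  linarith

end Summit.AtomisticToContinuum.FouriersLaw.Cruxes.IncoherentChannel.StrategistR1

end
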